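import Mathlib
import HarnessLib
import Summits.HubbardSuperconductivity.HubbardSuperconductivity.Theorems.KLProgrammeKLRegimeTwoCutoffScaleZeroLeg
import Summits.HubbardSuperconductivity.HubbardSuperconductivity.Theorems.KLProgrammeKLRegimeEngineTwoLegStepV17F2ZeroCloserU8

/-!
# The CUTOFF LEG of (E3f-F)₀ in the FLOW currency: the `hcut` hypothesis of the registered scale-`0` two-leg closers
# `EngineV8.stub_twoLeg_scale0_of_nestedLegs_U9 / _U8 / _U7` (crux `KLRegimeEngineV17F2`, stmt-HubbardSuperconductivity-20437, stub (M))

Cell `gate-hubbard-kl`, seat hubbard-kl-k3c4-p2 (g6).  The scale-`0` flow frame is the bare frame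
(`klFlowFrameU L M β U μ 0 = 0`, `klFlowFrameU_zero`, `rfl`), so the fixed-frame cutoff leg of `…TwoCutoffScaleZeroLeg`
(`abs_klLocalPart_zero_sub_le_inv_of_cutoffs`: `|klLocalPart L M₁ … K 0 θ − klLocalPart L M₂ … K 0 θ| ≤ 1/L` for all
`M₂ ≥ M₁ ≥ 2^{10}(⌈|β|⌉₊+1)²(L+1)²` at any admissible frame `K`, `0 < U ≤ 2^{-128}/Rsq⁴`) IS the flow-currency leg at `n = 0`:

* §1 `twoLeg_scale0_hcutF_of_small` — the leg at the flow frames of each cutoff, smallness form, `a = 1`;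
* §2 `twoLeg_scale0_hcutF_of_klEng` — the same under the engine's binders (`U ≤ klEngU₀4 P R c`, `klEngL₃ β U ≤ L ≤ L₁`,
  `(klEngQ6 P R).M0 β L₁ ≤ M₁`), for ANY comparison-history predicate (discarded: at `n = 0` the histories are empty) and with the
  quarter budget `(klEngQ6 P R).CL β 0 / 4 / L₁` of the closers (`1 ≤ 2^{60}·Psq²·Rsq²·(β²+1)/4`);
* §3 `twoLeg_scale0_hcutF_klEng9 / _klEng8 / _klEng7` — LITERALLY the `hcut` hypothesis of `stub_twoLeg_scale0_of_nestedLegs_U9 / _U8 / _U7`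
  (history `histV17F2 … ∧ TwoLegSlopes …` at `klEngGeo7 / klEngQ6 P R`), from the stub's own binders `R.WF2`, `μ ∈ klWindowC`, `0 < U ≤ klEngU₀9/8/7 P R c`,
  `klBetaMin ≤ β`, `klEngL₃ β U ≤ L` and its frame binder `FrameOK R U (nScales β) μ (klFlowFrameU L M β U μ 0)`.

* §4 `stub_twoLeg_scale0_of_spatialLeg_U9 / _U8` — stub (M) on its literal binders MODULO THE SPATIAL NESTED LEG `hsp` ONLY (the closers with
  `hcut` discharged by §3).

So the (M) assembler writes `(hcut := twoLeg_scale0_hcutF_klEng9 P hR c hμ hU hUle hβ hL hfr)`, or calls §4 with `hsp` alone.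
Proofs only; no definitions; nothing about the model is asserted beyond the cited upstream theorems; nothing asserts superconductivity.
References: BGM 2006 §2 (2.38)–(2.40), §3 (3.2)–(3.3) [cite: BenfattoGiulianiMastropietro2006].
-/

noncomputable section

namespace Summit.HubbardSuperconductivity.HubbardSuperconductivity.Theorems.TwoVolumeDefect

set_option linter.dupNamespace false -- summit = problem name (single-conjunct summit), D-0017

open Finset Literature.MathematicalPhysics.QuantumLattice Literature.Probability.LatticeModels
open Summit.HubbardSuperconductivity.HubbardSuperconductivity.Theorems.KLRegimeSplit
open Summit.HubbardSuperconductivity.HubbardSuperconductivity.Theorems.KLProgrammeLegKernels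
open Summit.HubbardSuperconductivity.HubbardSuperconductivity.Theorems.EngineV8

/-! ## §1 The leg at the flow frames of each cutoff (smallness form) -/

/-- **THE CUTOFF LEG AT SCALE 0 IN THE FLOW CURRENCY** (`a = 1`): for `R.WF`, `0 < U ≤ 2^{-128}/Rsq⁴`, `μ ∈ klWindowC`, the bare frame
admissible (`FrameOK R U Nsc μ 0` — e.g. the stub's own frame binder, `klFlowFrameU … 0 = 0`), `klBetaMin ≤ β ≤ L₁` and all cutoffs
`M₂ ≥ M₁ ≥ 2^{10}(⌈|β|⌉₊+1)²(L₁+1)²`: the scale-`0` readings of `(L₁, M₁)` and `(L₁, M₂)`, each at ITS OWN flow frame, differ by `≤ 1/L₁`. -/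
theorem twoLeg_scale0_hcutF_of_small {R : RenConsts} (hR : R.WF) {U : ℝ} (hU : 0 < U)
    (hUs : U ≤ 1 / ((2 : ℝ) ^ 128 * klEngRsq R ^ 4)) {Nsc : ℕ} {μ : ℝ} (hμ : μ ∈ klWindowC) (hK0 : FrameOK R U Nsc μ 0)
    {β : ℝ} (hβ : klBetaMin ≤ β) (L₁ M₁ M₂ : ℕ) [NeZero L₁] [NeZero M₁] [NeZero M₂] (hβL₁ : β ≤ L₁)
    (hM₁ : 2 ^ 10 * (⌈|β|⌉₊ + 1) ^ 2 * (L₁ + 1) ^ 2 ≤ M₁) (h12 : M₁ ≤ M₂) (θ : ℝ) :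
    |klLocalPart L₁ M₁ β U μ (klFlowFrameU L₁ M₁ β U μ 0) 0 θ -
        klLocalPart L₁ M₂ β U μ (klFlowFrameU L₁ M₂ β U μ 0) 0 θ| ≤ 1 / (L₁ : ℝ) := by
  simp only [klFlowFrameU_zero]
  exact abs_klLocalPart_zero_sub_le_inv_of_cutoffs hR hU hUs hμ hK0 hβ hβL₁ hM₁ h12 θ

/-! ## §2 Under the engine's binders, any (discarded) comparison history, quarter budget -/

/-- `4 ≤ (klEngQ6 P R).CL β 0 = 2^{60}·klEngPsq P²·klEngRsq R²·(β²+1)·4⁰`. -/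
theorem four_le_klEngQ6_CL_zero (P : SplitConsts) (R : RenConsts) (β : ℝ) : (4 : ℝ) ≤ (klEngQ6 P R).CL β 0 := by
  have hCL : (klEngQ6 P R).CL β 0 = 2 ^ 60 * klEngPsq P ^ 2 * klEngRsq R ^ 2 * (β ^ 2 + 1) * (4 : ℝ) ^ (0 : ℕ) := rfl
  rw [hCL, pow_zero, mul_one]
  have hP : (1 : ℝ) ≤ klEngPsq P ^ 2 := one_le_pow₀ (one_le_klEngPsq P)
  have hR : (1 : ℝ) ≤ klEngRsq R ^ 2 := one_le_pow₀ (one_le_klEngRsq R)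
  have hb : (1 : ℝ) ≤ β ^ 2 + 1 := by nlinarith [sq_nonneg β]
  calc (4 : ℝ) ≤ 2 ^ 60 * 1 * 1 * 1 := by norm_num
    _ ≤ 2 ^ 60 * klEngPsq P ^ 2 * klEngRsq R ^ 2 * (β ^ 2 + 1) := by gcongr

/-- **THE CUTOFF LEG OF (E3f-F)₀ UNDER THE ENGINE'S BINDERS, quarter budget**: for `R.WF`, `μ ∈ klWindowC`, `0 < U ≤ klEngU₀4 P R c`,
`klBetaMin ≤ β`, `klEngL₃ β U ≤ L`, the bare frame admissible (the stub's frame binder `FrameOK R U Nsc μ (klFlowFrameU L M β U μ 0)` at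
its own volume): for every reader threshold `Mq`, every `L₁ ≥ L`, all cutoffs `M₂ ≥ M₁ ≥ (klEngQ6 P R).M0 β L₁`, ANY comparison histories
(unused) and every angle, the scale-`0` readings at the flow frames differ by `≤ (klEngQ6 P R).CL β 0 / 4 / L₁`. -/
theorem twoLeg_scale0_hcutF_of_klEng (P : SplitConsts) {R : RenConsts} (hR : R.WF) (c : ℝ) {μ : ℝ} (hμ : μ ∈ klWindowC) {U : ℝ}
    (hU : 0 < U) (hU₀ : U ≤ klEngU₀4 P R c) {β : ℝ} (hβ : klBetaMin ≤ β) {L M : ℕ} [NeZero L] [NeZero M] (hL : klEngL₃ β U ≤ L)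
    {Nsc : ℕ} (hfr : FrameOK R U Nsc μ (klFlowFrameU L M β U μ 0))
    (hist : (L' M' : ℕ) → [NeZero L'] → [NeZero M'] → ℕ → Prop)
    (Mq : ℕ → ℕ) (L₁ M₁ M₂ : ℕ) [NeZero L₁] [NeZero M₁] [NeZero M₂] (hLL₁ : L ≤ L₁) (hM₁ : (klEngQ6 P R).M0 β L₁ ≤ M₁)
    (_hMq : Mq L₁ ≤ M₁) (h12 : M₁ ≤ M₂) (_h₁ : ∀ j < 0, hist L₁ M₁ j) (_h₂ : ∀ j < 0, hist L₁ M₂ j) (θ : ℝ) :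
    |klLocalPart L₁ M₁ β U μ (klFlowFrameU L₁ M₁ β U μ 0) 0 θ -
        klLocalPart L₁ M₂ β U μ (klFlowFrameU L₁ M₂ β U μ 0) 0 θ| ≤ (klEngQ6 P R).CL β 0 / 4 / L₁ := by
  have hβ128 : (128 : ℝ) ≤ β := by simpa [klBetaMin] using hβ
  have hL₁0 : (0 : ℝ) < L₁ := by exact_mod_cast Nat.pos_of_ne_zero (NeZero.ne L₁)
  -- `U ≤ 2^-128/Rsq⁴`
  have hUs : U ≤ 1 / ((2 : ℝ) ^ 128 * klEngRsq R ^ 4) := by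
    refine hU₀.trans ?_
    rw [klEngU₀4]
    have hRpos : 0 < klEngRsq R := lt_of_lt_of_le one_pos (one_le_klEngRsq R)
    refine one_div_le_one_div_of_le (by positivity) ?_
    have hP : (1 : ℝ) ≤ klEngPsq P ^ 4 := one_le_pow₀ (one_le_klEngPsq P)
    have hc2 : (1 : ℝ) ≤ c ^ 2 + 1 := by nlinarith [sq_nonneg c]
    calc (2 : ℝ) ^ 128 * klEngRsq R ^ 4 = (2 : ℝ) ^ 128 * 1 * klEngRsq R ^ 4 * 1 := by ring
      _ ≤ (2 : ℝ) ^ 128 * klEngPsq P ^ 4 * klEngRsq R ^ 4 * (c ^ 2 + 1) := by gcongr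
  -- `β ≤ L₁` from `klEngL₃ β U ≤ L ≤ L₁`
  have hβL₁ : β ≤ (L₁ : ℝ) := by
    have hL3 : (klEngL₃ β U : ℝ) ≤ L₁ := by exact_mod_cast hL.trans hLL₁
    refine le_trans ?_ hL3
    rw [klEngL₃]
    push_cast
    have hceil : β ≤ (⌈|β|⌉₊ : ℝ) + 1 := by
      have h1 : |β| ≤ (⌈|β|⌉₊ : ℝ) := Nat.le_ceil (|β|)
      have h2 : β ≤ |β| := le_abs_self β
      linarith
    have h1 : (1 : ℝ) ≤ ((⌈|U|⁻¹⌉₊ : ℝ) + 1) ^ 2 := by nlinarith [Nat.cast_nonneg (α := ℝ) ⌈|U|⁻¹⌉₊]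
    have hb1 : (1 : ℝ) ≤ (⌈|β|⌉₊ : ℝ) + 1 := by linarith [Nat.cast_nonneg (α := ℝ) ⌈|β|⌉₊]
    nlinarith [mul_le_mul hceil hb1 (by norm_num) (by positivity)]
  have hM₁' : 2 ^ 10 * (⌈|β|⌉₊ + 1) ^ 2 * (L₁ + 1) ^ 2 ≤ M₁ := by
    have : (klEngQ6 P R).M0 β L₁ = 2 ^ 10 * (⌈|β|⌉₊ + 1) ^ 2 * (L₁ + 1) ^ 2 := rfl
    rw [this] at hM₁; exact hM₁
  have hK0 : FrameOK R U Nsc μ 0 := by simpa only [klFlowFrameU_zero] using hfr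
  have h1 := twoLeg_scale0_hcutF_of_small hR hU hUs hμ hK0 hβ L₁ M₁ M₂ hβL₁ hM₁' h12 θ
  refine h1.trans (div_le_div_of_nonneg_right ?_ hL₁0.le)
  have h4 := four_le_klEngQ6_CL_zero P R β
  linarith

/-! ## §3 Literally the `hcut` hypotheses of the registered closers `stub_twoLeg_scale0_of_nestedLegs_U9 / _U8 / _U7` -/

/-- **`hcut` OF `EngineV8.stub_twoLeg_scale0_of_nestedLegs_U9`** (the REGISTERED keying, token #10 = `klEngU₀9`), from the stub's own binders
`R.WF2`, `μ ∈ klWindowC`, `0 < U ≤ klEngU₀9 P R c`, `klBetaMin ≤ β`, `klEngL₃ β U ≤ L`, `FrameOK R U (nScales β) μ (klFlowFrameU L M β U μ 0)`. -/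
theorem twoLeg_scale0_hcutF_klEng9 (P : SplitConsts) {R : RenConsts} (hR : R.WF2) (c : ℝ) {μ : ℝ} (hμ : μ ∈ klWindowC) {U : ℝ}
    (hU : 0 < U) (hU₀ : U ≤ klEngU₀9 P R c) {β : ℝ} (hβ : klBetaMin ≤ β) {L M : ℕ} [NeZero L] [NeZero M] (hL : klEngL₃ β U ≤ L)
    (hfr : FrameOK R U (nScales β) μ (klFlowFrameU L M β U μ 0)) :
    ∀ (Mq : ℕ → ℕ) (L₁ M₁ M₂ : ℕ) [NeZero L₁] [NeZero M₁] [NeZero M₂], L ≤ L₁ → (klEngQ6 P R).M0 β L₁ ≤ M₁ → Mq L₁ ≤ M₁ →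
      M₁ ≤ M₂ →
      (∀ j < 0, histV17F2 L₁ M₁ klEngGeo7 P (klEngQ6 P R) R β U μ j ∧ TwoLegSlopes L₁ M₁ R β U μ (klFlowFrameU L₁ M₁ β U μ j) j) →
      (∀ j < 0, histV17F2 L₁ M₂ klEngGeo7 P (klEngQ6 P R) R β U μ j ∧ TwoLegSlopes L₁ M₂ R β U μ (klFlowFrameU L₁ M₂ β U μ j) j) →
        ∀ θ : ℝ, |klLocalPart L₁ M₁ β U μ (klFlowFrameU L₁ M₁ β U μ 0) 0 θ -
          klLocalPart L₁ M₂ β U μ (klFlowFrameU L₁ M₂ β U μ 0) 0 θ| ≤ (klEngQ6 P R).CL β 0 / 4 / L₁ :=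
  fun Mq L₁ M₁ M₂ _ _ _ hLL₁ hM₁ hMq h12 h₁ h₂ θ =>
    twoLeg_scale0_hcutF_of_klEng P hR.1 c hμ hU (hU₀.trans (klEngU₀9_le_klEngU₀4 P R c)) hβ hL hfr
      (fun L' M' _ _ j => histV17F2 L' M' klEngGeo7 P (klEngQ6 P R) R β U μ j ∧ TwoLegSlopes L' M' R β U μ (klFlowFrameU L' M' β U μ j) j)
      Mq L₁ M₁ M₂ hLL₁ hM₁ hMq h12 h₁ h₂ θ

/-- **`hcut` OF `EngineV8.stub_twoLeg_scale0_of_nestedLegs_U8`** (keying `klEngU₀8`, all-scales P-free door). -/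
theorem twoLeg_scale0_hcutF_klEng8 (P : SplitConsts) {R : RenConsts} (hR : R.WF2) (c : ℝ) {μ : ℝ} (hμ : μ ∈ klWindowC) {U : ℝ}
    (hU : 0 < U) (hU₀ : U ≤ klEngU₀8 P R c) {β : ℝ} (hβ : klBetaMin ≤ β) {L M : ℕ} [NeZero L] [NeZero M] (hL : klEngL₃ β U ≤ L)
    (hfr : FrameOK R U (nScales β) μ (klFlowFrameU L M β U μ 0)) :
    ∀ (Mq : ℕ → ℕ) (L₁ M₁ M₂ : ℕ) [NeZero L₁] [NeZero M₁] [NeZero M₂], L ≤ L₁ → (klEngQ6 P R).M0 β L₁ ≤ M₁ → Mq L₁ ≤ M₁ →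
      M₁ ≤ M₂ →
      (∀ j < 0, histV17F2 L₁ M₁ klEngGeo7 P (klEngQ6 P R) R β U μ j ∧ TwoLegSlopes L₁ M₁ R β U μ (klFlowFrameU L₁ M₁ β U μ j) j) →
      (∀ j < 0, histV17F2 L₁ M₂ klEngGeo7 P (klEngQ6 P R) R β U μ j ∧ TwoLegSlopes L₁ M₂ R β U μ (klFlowFrameU L₁ M₂ β U μ j) j) →
        ∀ θ : ℝ, |klLocalPart L₁ M₁ β U μ (klFlowFrameU L₁ M₁ β U μ 0) 0 θ -
          klLocalPart L₁ M₂ β U μ (klFlowFrameU L₁ M₂ β U μ 0) 0 θ| ≤ (klEngQ6 P R).CL β 0 / 4 / L₁ :=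
  fun Mq L₁ M₁ M₂ _ _ _ hLL₁ hM₁ hMq h12 h₁ h₂ θ =>
    twoLeg_scale0_hcutF_of_klEng P hR.1 c hμ hU (hU₀.trans (klEngU₀8_le_klEngU₀4 P R c)) hβ hL hfr
      (fun L' M' _ _ j => histV17F2 L' M' klEngGeo7 P (klEngQ6 P R) R β U μ j ∧ TwoLegSlopes L' M' R β U μ (klFlowFrameU L' M' β U μ j) j)
      Mq L₁ M₁ M₂ hLL₁ hM₁ hMq h12 h₁ h₂ θ

/-- **`hcut` OF `EngineV8.stub_twoLeg_scale0_of_nestedLegs_U7`** (keying `klEngU₀7`, scale-0 sub-door). -/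
theorem twoLeg_scale0_hcutF_klEng7 (P : SplitConsts) {R : RenConsts} (hR : R.WF2) (c : ℝ) {μ : ℝ} (hμ : μ ∈ klWindowC) {U : ℝ}
    (hU : 0 < U) (hU₀ : U ≤ klEngU₀7 P R c) {β : ℝ} (hβ : klBetaMin ≤ β) {L M : ℕ} [NeZero L] [NeZero M] (hL : klEngL₃ β U ≤ L)
    (hfr : FrameOK R U (nScales β) μ (klFlowFrameU L M β U μ 0)) :
    ∀ (Mq : ℕ → ℕ) (L₁ M₁ M₂ : ℕ) [NeZero L₁] [NeZero M₁] [NeZero M₂], L ≤ L₁ → (klEngQ6 P R).M0 β L₁ ≤ M₁ → Mq L₁ ≤ M₁ →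
      M₁ ≤ M₂ →
      (∀ j < 0, histV17F2 L₁ M₁ klEngGeo7 P (klEngQ6 P R) R β U μ j ∧ TwoLegSlopes L₁ M₁ R β U μ (klFlowFrameU L₁ M₁ β U μ j) j) →
      (∀ j < 0, histV17F2 L₁ M₂ klEngGeo7 P (klEngQ6 P R) R β U μ j ∧ TwoLegSlopes L₁ M₂ R β U μ (klFlowFrameU L₁ M₂ β U μ j) j) →
        ∀ θ : ℝ, |klLocalPart L₁ M₁ β U μ (klFlowFrameU L₁ M₁ β U μ 0) 0 θ -
          klLocalPart L₁ M₂ β U μ (klFlowFrameU L₁ M₂ β U μ 0) 0 θ| ≤ (klEngQ6 P R).CL β 0 / 4 / L₁ :=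
  fun Mq L₁ M₁ M₂ _ _ _ hLL₁ hM₁ hMq h12 h₁ h₂ θ =>
    twoLeg_scale0_hcutF_of_klEng P hR.1 c hμ hU (hU₀.trans (klEngU₀7_le_klEngU₀4 P R c)) hβ hL hfr
      (fun L' M' _ _ j => histV17F2 L' M' klEngGeo7 P (klEngQ6 P R) R β U μ j ∧ TwoLegSlopes L' M' R β U μ (klFlowFrameU L' M' β U μ j) j)
      Mq L₁ M₁ M₂ hLL₁ hM₁ hMq h12 h₁ h₂ θ

/-! ## §4 Stub (M) of 20437 modulo the SPATIAL nested leg only (the cutoff leg supplied by §3) -/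

/-- **STUB (M) `stub_twoLeg_scale0` OF `KLRegimeEngineV17F2` ON ITS LITERAL (REGISTERED, `klEngU₀9`) BINDERS, MODULO THE SPATIAL NESTED LEG `hsp` ONLY**:
`EngineV8.stub_twoLeg_scale0_of_nestedLegs_U9` with its cutoff leg `hcut` discharged by `twoLeg_scale0_hcutF_klEng9`. -/
theorem stub_twoLeg_scale0_of_spatialLeg_U9 (P : SplitConsts) (R : RenConsts) (c : ℝ) (hP : P.WF) (hR : R.WF2) (hc : 0 < c)
    (hc3 : c ≤ klEngC₃6 P R) (μ : ℝ) (hμ : μ ∈ klWindowC) (U : ℝ) (hU : 0 < U) (hUle : U ≤ klEngU₀9 P R c) (β : ℝ) (hβ : klBetaMin ≤ β)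
    (hβc : β ≤ Real.exp (c / U ^ 2)) (L M : ℕ) [NeZero L] [NeZero M] (hL : klEngL₃ β U ≤ L) (hM : klEngM₃ β U L ≤ M)
    (hfr : FrameOK R U (nScales β) μ (klFlowFrameU L M β U μ 0))
    (hE : EngineBoundsAtV17F2 L M klEngGeo7 P (klEngQ6 P R) β U μ 0)
    (hJ : TwoLegReadJetBound L M klC4aJetC (klC4aJetC' P R) β U μ (klFlowFrameU L M β U μ 0) 0)
    (hsp : ∀ (Mq : ℕ → ℕ) (L₁ L₂ M₂ : ℕ) [NeZero L₁] [NeZero L₂] [NeZero M₂], L ≤ L₁ → L₁ ∣ L₂ → (klEngQ6 P R).M0 β L₁ ≤ M₂ →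
      Mq L₁ ≤ M₂ → (klEngQ6 P R).M0 β L₂ ≤ M₂ → Mq L₂ ≤ M₂ →
      (∀ j < 0, histV17F2 L₁ M₂ klEngGeo7 P (klEngQ6 P R) R β U μ j ∧ TwoLegSlopes L₁ M₂ R β U μ (klFlowFrameU L₁ M₂ β U μ j) j) →
      (∀ j < 0, histV17F2 L₂ M₂ klEngGeo7 P (klEngQ6 P R) R β U μ j ∧ TwoLegSlopes L₂ M₂ R β U μ (klFlowFrameU L₂ M₂ β U μ j) j) →
        ∀ θ : ℝ, |klLocalPart L₁ M₂ β U μ (klFlowFrameU L₁ M₂ β U μ 0) 0 θ -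
          klLocalPart L₂ M₂ β U μ (klFlowFrameU L₂ M₂ β U μ 0) 0 θ| ≤ (klEngQ6 P R).CL β 0 / 4 / L₁) :
    TwoLegStepV17F2 L M klEngGeo7 P (klEngQ6 P R) R β U μ 0 :=
  stub_twoLeg_scale0_of_nestedLegs_U9 P R c hP hR hc hc3 μ hμ U hU hUle β hβ hβc L M hL hM hfr hE hJ
    (twoLeg_scale0_hcutF_klEng9 P hR c hμ hU hUle hβ hL hfr) hsp

/-- **The same at the keying `klEngU₀8`** (`EngineV8.stub_twoLeg_scale0_of_nestedLegs_U8` with `hcut := twoLeg_scale0_hcutF_klEng8 …`). -/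
theorem stub_twoLeg_scale0_of_spatialLeg_U8 (P : SplitConsts) (R : RenConsts) (c : ℝ) (hP : P.WF) (hR : R.WF2) (hc : 0 < c)
    (hc3 : c ≤ klEngC₃6 P R) (μ : ℝ) (hμ : μ ∈ klWindowC) (U : ℝ) (hU : 0 < U) (hUle : U ≤ klEngU₀8 P R c) (β : ℝ) (hβ : klBetaMin ≤ β)
    (hβc : β ≤ Real.exp (c / U ^ 2)) (L M : ℕ) [NeZero L] [NeZero M] (hL : klEngL₃ β U ≤ L) (hM : klEngM₃ β U L ≤ M)
    (hfr : FrameOK R U (nScales β) μ (klFlowFrameU L M β U μ 0))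
    (hE : EngineBoundsAtV17F2 L M klEngGeo7 P (klEngQ6 P R) β U μ 0)
    (hJ : TwoLegReadJetBound L M klC4aJetC (klC4aJetC' P R) β U μ (klFlowFrameU L M β U μ 0) 0)
    (hsp : ∀ (Mq : ℕ → ℕ) (L₁ L₂ M₂ : ℕ) [NeZero L₁] [NeZero L₂] [NeZero M₂], L ≤ L₁ → L₁ ∣ L₂ → (klEngQ6 P R).M0 β L₁ ≤ M₂ →
      Mq L₁ ≤ M₂ → (klEngQ6 P R).M0 β L₂ ≤ M₂ → Mq L₂ ≤ M₂ →
      (∀ j < 0, histV17F2 L₁ M₂ klEngGeo7 P (klEngQ6 P R) R β U μ j ∧ TwoLegSlopes L₁ M₂ R β U μ (klFlowFrameU L₁ M₂ β U μ j) j) →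
      (∀ j < 0, histV17F2 L₂ M₂ klEngGeo7 P (klEngQ6 P R) R β U μ j ∧ TwoLegSlopes L₂ M₂ R β U μ (klFlowFrameU L₂ M₂ β U μ j) j) →
        ∀ θ : ℝ, |klLocalPart L₁ M₂ β U μ (klFlowFrameU L₁ M₂ β U μ 0) 0 θ -
          klLocalPart L₂ M₂ β U μ (klFlowFrameU L₂ M₂ β U μ 0) 0 θ| ≤ (klEngQ6 P R).CL β 0 / 4 / L₁) :
    TwoLegStepV17F2 L M klEngGeo7 P (klEngQ6 P R) R β U μ 0 :=
  stub_twoLeg_scale0_of_nestedLegs_U8 P R c hP hR hc hc3 μ hμ U hU hUle β hβ hβc L M hL hM hfr hE hJ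
    (twoLeg_scale0_hcutF_klEng8 P hR c hμ hU hUle hβ hL hfr) hsp

end Summit.HubbardSuperconductivity.HubbardSuperconductivity.Theorems.TwoVolumeDefect

end
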